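import Summits.NavierStokesRegularity.NavierStokesRegularity.Theorems.AxisymmetricExtremalityAxisymmetricKatoGlobalStubSeregin2020TypeIILemma22AssemblyFinal
import Summits.NavierStokesRegularity.NavierStokesRegularity.Theorems.AxisymmetricExtremalityAxisymmetricKatoGlobalStubSeregin2020TypeIILemma22MoserIteration
import Summits.NavierStokesRegularity.NavierStokesRegularity.Theorems.AxisymmetricExtremalityAxisymmetricKatoGlobalStubSeregin2020TypeIILemma22MoserStep
import HarnessLib

/-!
# Seregin 2020, Theorem 2.1 — the named fact `Seregin2020_axisymmetricSingularPoint_typeII`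
# DISCHARGED, and the registered stub `stub_seregin2020TypeII` of the crux `AxisymmetricKatoGlobal`

G. Seregin, *A note on local regularity of axisymmetric solutions to the Navier–Stokes
equations*, Anal. Math. Phys. 10 (2020) 46 = arXiv:2006.04140, **Theorem 2.1**: an axisymmetric
suitable weak solution in the unit parabolic cylinder whose origin is a singular point blows up at
a rate NOT of Type I (the blow-up index `g(0) = min{limsup A, limsup C, limsup E}` is `+∞`). The
tree's 53-file Seregin-2020 programme (lines `AxisymmetricExtremality…StubSeregin2020TypeII*`)
reduced the statement to Lemma 2.2 (= Nazarov–Uraltseva 2012, Lemma 4.2 in the class 𝒱), and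
Lemma 2.2 to two inputs: the Moser one-step estimate `lemma22_moserStep` (M1, N–U (3.2)–(3.6)) and
the energy class of the normalised pair across the axis set `S` (L22-B); both are now kernel
theorems, and `seregin2020_typeII_of_smallSublevel_lowerBound` (the assembly) takes the registered
atom `lemma22_smallSublevel_lowerBound` (N–U Lemma 3.1 + Cor 3.1 (2) + Remark 6), which the landed
Moser iteration `lemma22_smallSublevel_lowerBound_of_moserStep` (M2) derives from M1.

* `Seregin2020_axisymmetricSingularPoint_typeII_holds` — the Literature fact, proved;
* `stub_seregin2020TypeII` — the registered stub of stmt-NavierStokesRegularity-15453 (same type).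

WHAT THIS IS NOT: a printed theorem (Seregin 2020, Thm 2.1) is re-proved in the kernel from the
tree's definitions; conditional lines that consumed the named fact become unconditional AS TYPED.
No Navier–Stokes regularity / blow-up exclusion statement is proved; the crux
`AxisymmetricKatoGlobal` and the summit are untouched.

## References

* G. Seregin, Anal. Math. Phys. 10 (2020), Paper 46 = arXiv:2006.04140, Thm 2.1, Lemma 2.2.
  [Seregin2020]
* A. I. Nazarov, N. N. Uraltseva, St. Petersburg Math. J. 23 (2012) 93–115 = arXiv:1011.1888,
  Lemma 3.1–3.3, Cor 3.1–3.3, Lemma 4.2. [NazarovUraltseva2012]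
-/

-- the problem directory repeats the summit name (D-0017); core's `dupNamespace` linter fires
set_option linter.dupNamespace false

noncomputable section

open MeasureTheory Set Function Filter Topology TopologicalSpace Metric
open scoped NNReal ENNReal

namespace Summit.NavierStokesRegularity.NavierStokesRegularity.Theorems.AxisymmetricKatoGlobal.EulerScaling

open Literature.Analysis.FluidPDE Literature.Analysis.FluidPDE.Seregin2020

/-- **Seregin 2020, Theorem 2.1** (the named fact `Seregin2020_axisymmetricSingularPoint_typeII`,
discharged): an axisymmetric suitable weak solution in `Q(0,1)` with the origin a singular point
has blow-up index `g(0) = +∞` (Type II). Assembly `seregin2020_typeII_of_smallSublevel_lowerBound`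
applied to the atom obtained from the Moser one-step estimate `lemma22_moserStep` by the iteration
`lemma22_smallSublevel_lowerBound_of_moserStep`. [cite: Seregin2020, Thm 2.1 (arXiv:2006.04140 pp. 4–8)] -/
theorem Seregin2020_axisymmetricSingularPoint_typeII_holds :
    Seregin2020_axisymmetricSingularPoint_typeII :=
  seregin2020_typeII_of_smallSublevel_lowerBound
    (lemma22_smallSublevel_lowerBound_of_moserStep lemma22_moserStep)

/-- **The registered stub `stub_seregin2020TypeII` of stmt-NavierStokesRegularity-15453** (crux
`AxisymmetricKatoGlobal`, line EulerScaling): the named fact Seregin 2020, Thm 2.1, now a theorem.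
[cite: Seregin2020, Thm 2.1] -/
theorem stub_seregin2020TypeII : Seregin2020_axisymmetricSingularPoint_typeII :=
  Seregin2020_axisymmetricSingularPoint_typeII_holds

end Summit.NavierStokesRegularity.NavierStokesRegularity.Theorems.AxisymmetricKatoGlobal.EulerScaling

end
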